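/-
Copyright (c) 2026 the pub-hodgecm-mathlib formalisation cell (harness21).  Prover seat hodgecm-mathlib-K2Liu-p02 (g3), Track B «K2-LIT» ∕
hLiu418 #184♮, unit U6 «FIRST TERM AT THE TOP POLE», socket #42R `sig_K2LiuEisensteinResidueIsThetaIntegral` (steward lineage K2Liu-p02):
organ O42.3g «THE COHERENT GENERATOR, PACKAGED» — the μ-twisted Siegel–Weil standard family of a hermitian `M₂`-frame is a CONTINUOUS
STANDARD family (the section half of the generator property of the glue).  2026-09-04.
-/
import Literature.NumberTheory.K2Lit.SiegelWeilSectionTensor                                    -- ★ p856679 (O42.3b): `swSectionTensor`, `isSiegelDeltaSection_swSectionTensor`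
import Summits.HodgeConjecture.HodgeConjecture.Theorems.K2LiuSiegelWeilSectionKFinite             -- ★ p856329: `swSection_mul_right`
import Summits.HodgeConjecture.HodgeConjecture.Theorems.K2LiuSiegelWeilSectionContinuous         -- ★ p856888 (O42.3e): quotient-map lemma, character continuity, finite-dimensional step, `continuous_stdExtension`
import Summits.HodgeConjecture.HodgeConjecture.Theorems.K2LiuSiegelSectionDetTwist               -- ★ p856963 (O42.3f): `isStandardSectionFamily_detTwist`, `continuous_detTwist`
import Summits.HodgeConjecture.HodgeConjecture.Theorems.K2LiuIwasawaDeltaUnimodular              -- ★ p856285: `IwasawaDatum.modDelta_eq_one_of_mem`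
import HarnessLib

/-!
# K2_Liu road (hLiu418 = stmt-HodgeConjecture-24832), unit U6 «FIRST TERM», socket #42R: organ O42.3g —
# THE COHERENT GENERATOR of the SPAN socket-to-be, packaged: a continuous standard family for `(𝒦, χ^{M₂}·α̃)`

Cell `pub/hodgecm-mathlib` (D-0151), Track B; socket #42R `sig_K2LiuEisensteinResidueIsThetaIntegral` (U6 :363; steward lineage K2Liu-p02;
SPEC v2 `K2/K2Liu-p02/g3/SPEC-42R-v2-GlueAndGenerators.K2Liup02g3.md` §3 (a)).

The generator class of the road (SPEC v2 §3 (a)) consists of the families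
  `g(s, h) := α(det h) · (|det_Δ p_h|^{1/2})^{2(s − s₀)} · f_Φ^{V′}(h)`,  `s₀ = (M₂ − n)/2`,
where `f_Φ^{V′} = swSectionTensor sB Φ` (★ O42.3b) is the Siegel–Weil section of a hermitian `M₂`-frame `dV′` for a `χ`-normalised doubled Weil
representation `sB` of the BIG datum `(dV, dW ⊗ dV′)` (★ `IsDoubledWeilRep`), `Φ` is `K`-finite for the SMALL Iwasawa datum `𝒦` read in the big group
(`span{ω(sB(h ⊗ 1_{V′}))Φ : h = k ∈ K}` finite-dimensional), and `α` is a continuous automorphic character of `U(1)(𝔸_{L⁺})` (★ `ratioHecke`).  The glue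
★ `residueIsThetaLift_of_generators` (p856790) asks of a generator: continuous section family in `I(·, χ_D)` + a continuation with the theta residue.
THIS FILE certifies the SECTION HALF by name, for `χ_D = χ^{M₂}·α̃` (for hLiu418: `n = 2`, `M₂ = 3`, `χ := λ̃⁻¹`, `α̃ := λ̃²`, so `χ_D = λ̃⁻¹`):

* §1 `swSectionTensor_mul_right` — `f_Φ^{V′}(h k) = f_{ω(sB(k ⊗ 1))Φ}^{V′}(h)` (★ `swSection_mul_right` on the big datum, `tensorEmb` a homomorphism);
  `isKFinite_swSectionTensor` — `K`-finiteness for the SMALL datum `𝒦` from the finite-dimensionality of the `tensorEmb(K)`-orbit span of `Φ`;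
* §2 `continuous_swSectionTensor` — continuity on `H(𝔸)` under the same hypothesis (★ O42.3e's three lemmas: the closed × compact quotient map
  `P_Δ(𝔸) × K → H(𝔸)`, continuity of the inducing character of `χ^{M₂}` at `s₀`, and the finite-dimensional step for the orbit
  `k ↦ ω(sB(k ⊗ 1))Φ` through the fixed operator `ω(r_F(δ′))`);
* §3 **`isStandardSectionFamily_swTensorTwisted`**, **`continuous_swTensorTwisted`**, `isSiegelDeltaSection_swTensorTwisted` — THE PACKAGE: the family
  `s h ↦ α(det h) · stdExtension 𝒦 s₀ (swSectionTensor sB Φ) s h` is a STANDARD family for `(𝒦, χ^{M₂}·α̃)` (★ `isStandardSectionFamily_stdExtension` with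
  ★ `IwasawaDatum.modDelta_eq_one_of_mem`, then ★ `isStandardSectionFamily_detTwist`) and CONTINUOUS in `h` for every `s` (★ `continuous_stdExtension`, ★
  `continuous_detTwist`) — i.e. it meets the binders `hg`, `hgc` of the glue and the flatness that ★ `eq_finset_sum_of_apply_eq_on_K` (SPAN) wants.

Mathlib + ★ only; no `sorry`, no definition, no instance, no notation.  HONEST LABEL: HC_CM is proved only modulo the 7 printed citations
(2 remaining named inputs: hLiu418 = stmt-HodgeConjecture-24832, h413 = stmt-HodgeConjecture-24833) until rung 0 closes; this file is a
`--supports stmt-HodgeConjecture-24832` helper of the #42R road (it retires nothing by itself; the theta half of the generator property — the first-term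
identity #42F with O42.4 ∕ O42.9 — and the SPAN #42S are the named inputs).

References: [KudlaRallis1994] S. Kudla, S. Rallis, Ann. of Math. 140 (1994) §1 (standard Siegel–Weil sections); [HarrisKudlaSweet1996] §1 (1.15)–(1.17);
[GelbartRogawski1991] §3.1 Remark p. 457 (det-twists); [Tan1999] §1; [Weil1964] Chap. III n° 39.
-/

set_option autoImplicit false
set_option linter.dupNamespace false
-- the doubled metaplectic carriers elaborate slowly (cf. ★ `SiegelWeilSectionTensor`): term-mode chains, sequential elaboration
set_option Elab.async false

noncomputable section

open NumberField MeasureTheory IsDedekindDomain Filter Topology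
open scoped Matrix

namespace Summit.HodgeConjecture.HodgeConjecture.Cruxes.HLiu418.K2LiuSiegelWeilTensorGenerator

open Literature.NumberTheory.Automorphic Literature.NumberTheory.Automorphic.UnitaryGroup Literature.NumberTheory.GaloisRepresentations
open Literature.NumberTheory.GelbartRogawski1991 Literature.NumberTheory.GelbartRogawski1991.GRConstruction
open Literature.NumberTheory.GelbartRogawski1991.GRConstruction.DoubledWeilDetTwist
open Literature.NumberTheory.Weil1964
open Literature.NumberTheory.K2Lit.SiegelDoubled
open Summit.HodgeConjecture.HodgeConjecture.Cruxes.HLiu418.K2LiuSiegelWeilSectionKFinite (swSection_mul_right)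
open Summit.HodgeConjecture.HodgeConjecture.Cruxes.HLiu418.K2LiuSiegelWeilSectionContinuous
open Summit.HodgeConjecture.HodgeConjecture.Cruxes.HLiu418.K2LiuSiegelSectionDetTwist
open Summit.HodgeConjecture.HodgeConjecture.Cruxes.HLiu418.K2LiuSiegelDoubledParabolicReduction (isClosed_siegelDelta)
open Summit.HodgeConjecture.HodgeConjecture.Cruxes.HLiu418.K2LiuIwasawaDeltaUnimodular

variable (L : Type) [Field L] [NumberField L] [IsCMField L]
variable {N M n : ℕ} (e : Fin N × Fin M ≃ Fin n)
  (dV : Fin N → L) (hdV : ∀ i, IsCMField.complexConj L (dV i) = dV i) (hdV0 : ∀ i, dV i ≠ 0)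
  (dW : Fin M → L) (hdW : ∀ i, IsCMField.complexConj L (dW i) = dW i) (hdW0 : ∀ i, dW i ≠ 0)
variable {M₂ M' n' : ℕ} (eW : Fin M × Fin M₂ ≃ Fin M') (e' : Fin N × Fin M' ≃ Fin n')
  (dV' : Fin M₂ → L) (hdV' : ∀ k, IsCMField.complexConj L (dV' k) = dV' k) (hdV'0 : ∀ k, dV' k ≠ 0)

/-! ## §1 Right translation and `K`-finiteness of the Siegel–Weil section of an `M₂`-frame, for the SMALL Iwasawa datum -/

/-- **`f_Φ^{V′}(h k) = f_{ω(sB(k ⊗ 1))Φ}^{V′}(h)`**: right translation on the small group acts on `Φ` through the big Weil representation along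
`tensorEmb` (★ `swSection_mul_right` on the big datum). [cite: KudlaRallis1994, §1] [cite: HarrisKudlaSweet1996, §1 (1.16)] -/
theorem swSectionTensor_mul_right
    (sB : HA L e' dV hdV (tensorFrame L dW eW dV') (tensorFrame_real L dW hdW eW dV' hdV') →*
      MpD L e' dV hdV (tensorFrame L dW eW dV') (tensorFrame_real L dW hdW eW dV' hdV'))
    (Φ : piSchwartzBruhat (Fp L) (Fin (n' + n'))) (h k : HA L e dV hdV dW hdW) :
    swSectionTensor L e dV hdV dW hdW eW e' dV' hdV' hdV0 hdW0 hdV'0 sB Φ (h * k) =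
      swSectionTensor L e dV hdV dW hdW eW e' dV' hdV' hdV0 hdW0 hdV'0 sB
        (adelicMpCont.omega (Fp L) (Fin (n' + n')) (gramDA L e' dV hdV (tensorFrame L dW eW dV') (tensorFrame_real L dW hdW eW dV' hdV'))
          (sB (tensorEmb L e dV hdV dW hdW eW e' dV' hdV' k)) Φ) h := by
  have hm := (tensorEmb L e dV hdV dW hdW eW e' dV' hdV').map_mul h k
  exact (congrArg (fun x => swSection L e' dV hdV hdV0 (tensorFrame L dW eW dV') (tensorFrame_real L dW hdW eW dV' hdV')
      (tensorFrame_ne_zero L dW eW dV' hdW0 hdV'0) sB Φ x) hm).trans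
    (swSection_mul_right L e' dV hdV hdV0 _ _ _ sB Φ _ _)

/-- **`K`-FINITENESS for the SMALL datum**: if the span of `{ω(sB(k ⊗ 1))Φ : k ∈ K}` is finite-dimensional then `f_Φ^{V′}` is `K`-finite for `𝒦`
(its right `K`-translates lie in the image of that span under the linear map `Ψ ↦ f_Ψ^{V′}`). [cite: KudlaRallis1994, §1] [cite: Tan1999, §1] -/
theorem isKFinite_swSectionTensor (𝒦 : IwasawaDatum L e dV hdV dW hdW)
    (sB : HA L e' dV hdV (tensorFrame L dW eW dV') (tensorFrame_real L dW hdW eW dV' hdV') →*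
      MpD L e' dV hdV (tensorFrame L dW eW dV') (tensorFrame_real L dW hdW eW dV' hdV'))
    (Φ : piSchwartzBruhat (Fp L) (Fin (n' + n')))
    (hΦ : FiniteDimensional ℂ (Submodule.span ℂ (Set.range fun k : 𝒦.K =>
      adelicMpCont.omega (Fp L) (Fin (n' + n')) (gramDA L e' dV hdV (tensorFrame L dW eW dV') (tensorFrame_real L dW hdW eW dV' hdV'))
        (sB (tensorEmb L e dV hdV dW hdW eW e' dV' hdV' (k : HA L e dV hdV dW hdW))) Φ))) :
    Literature.NumberTheory.K2Lit.SiegelDoubled.IsKFinite 𝒦 (swSectionTensor L e dV hdV dW hdW eW e' dV' hdV' hdV0 hdW0 hdV'0 sB Φ) := by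
  -- the linear map `Ψ ↦ f_Ψ^{V′}`
  let F : piSchwartzBruhat (Fp L) (Fin (n' + n')) →ₗ[ℂ] (HA L e dV hdV dW hdW → ℂ) :=
    { toFun := fun Ψ => swSectionTensor L e dV hdV dW hdW eW e' dV' hdV' hdV0 hdW0 hdV'0 sB Ψ
      map_add' := fun Ψ Ψ' => funext fun h => swSectionTensor_add L e dV hdV dW hdW eW e' dV' hdV' hdV0 hdW0 hdV'0 sB Ψ Ψ' h
      map_smul' := fun c Ψ => funext fun h => swSectionTensor_smul L e dV hdV dW hdW eW e' dV' hdV' hdV0 hdW0 hdV'0 sB c Ψ h }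
  have hle : rightTranslateSpan 𝒦 (swSectionTensor L e dV hdV dW hdW eW e' dV' hdV' hdV0 hdW0 hdV'0 sB Φ) ≤
      (Submodule.span ℂ (Set.range fun k : 𝒦.K =>
        adelicMpCont.omega (Fp L) (Fin (n' + n')) (gramDA L e' dV hdV (tensorFrame L dW eW dV') (tensorFrame_real L dW hdW eW dV' hdV'))
          (sB (tensorEmb L e dV hdV dW hdW eW e' dV' hdV' (k : HA L e dV hdV dW hdW))) Φ)).map F := by
    refine Submodule.span_le.2 ?_
    rintro _ ⟨k, rfl⟩
    refine ⟨_, Submodule.subset_span ⟨k, rfl⟩, funext fun h => ?_⟩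
    exact (swSectionTensor_mul_right L e dV hdV hdV0 dW hdW hdW0 eW e' dV' hdV' hdV'0 sB Φ h k).symm
  unfold Literature.NumberTheory.K2Lit.SiegelDoubled.IsKFinite
  haveI := hΦ
  exact Submodule.finiteDimensional_of_le hle

/-! ## §2 Continuity of the Siegel–Weil section of an `M₂`-frame -/

include hdV'0 in
/-- **`f_Φ^{V′}` is continuous on `H(𝔸)`** for `sB` a `χ`-normalised doubled Weil representation of the big datum, `M₂ ≠ 0`, and `Φ` with finite-dimensional
`tensorEmb(K)`-orbit span: `f(p k) = χ^{M₂}_{s₀}(p)·f(k)` (★ `isSiegelDeltaSection_swSectionTensor`) is continuous on `P_Δ(𝔸) × K` (★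
`continuous_siegelDeltaCharacter_subtype`; ★ `continuous_apply_linearMap_of_finiteDimensional_span` for the coefficient-continuous orbit
`k ↦ ω(sB(k ⊗ 1))Φ` through `ω(r_F(δ′))`), and `P_Δ(𝔸) × K → H(𝔸)` is a quotient map (★ `continuous_of_continuous_mul_decomposition`).
[cite: KudlaRallis1994, §1] [cite: Weil1964, Chap. III n° 39 p. 189] -/
theorem continuous_swSectionTensor (hM₂ : M₂ ≠ 0) {χ : HeckeCharacter L}
    {sB : HA L e' dV hdV (tensorFrame L dW eW dV') (tensorFrame_real L dW hdW eW dV' hdV') →*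
      MpD L e' dV hdV (tensorFrame L dW eW dV') (tensorFrame_real L dW hdW eW dV' hdV')}
    (hsB : IsDoubledWeilRep L e' dV hdV hdV0 (tensorFrame L dW eW dV') (tensorFrame_real L dW hdW eW dV' hdV')
      (tensorFrame_ne_zero L dW eW dV' hdW0 hdV'0) χ sB)
    (𝒦 : IwasawaDatum L e dV hdV dW hdW) (Φ : piSchwartzBruhat (Fp L) (Fin (n' + n')))
    (hΦ : FiniteDimensional ℂ (Submodule.span ℂ (Set.range fun k : 𝒦.K =>
      adelicMpCont.omega (Fp L) (Fin (n' + n')) (gramDA L e' dV hdV (tensorFrame L dW eW dV') (tensorFrame_real L dW hdW eW dV' hdV'))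
        (sB (tensorEmb L e dV hdV dW hdW eW e' dV' hdV' (k : HA L e dV hdV dW hdW))) Φ))) :
    Continuous (swSectionTensor L e dV hdV dW hdW eW e' dV' hdV' hdV0 hdW0 hdV'0 sB Φ) := by
  refine continuous_of_continuous_mul_decomposition (siegelDelta L e dV hdV dW hdW) 𝒦.K
    (isClosed_siegelDelta L e dV hdV dW hdW) 𝒦.isCompact_K (fun h => ?_) ?_
  · obtain ⟨p, k, hp, hk, hh⟩ := 𝒦.iwasawa h
    exact ⟨p, k, hp, hk, hh⟩
  · have hsec := isSiegelDeltaSection_swSectionTensor L e dV hdV dW hdW eW e' dV' hdV' hdV0 hdW0 hdV'0 hM₂ hsB Φ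
    have heq : (fun x : siegelDelta L e dV hdV dW hdW × 𝒦.K =>
        swSectionTensor L e dV hdV dW hdW eW e' dV' hdV' hdV0 hdW0 hdV'0 sB Φ ((x.1 : HA L e dV hdV dW hdW) * (x.2 : HA L e dV hdV dW hdW))) =
        fun x => siegelDeltaCharacter L e dV hdV dW hdW (χ ^ M₂) (((M₂ : ℂ) - (n : ℂ)) / 2) (x.1 : HA L e dV hdV dW hdW) *
          swSectionTensor L e dV hdV dW hdW eW e' dV' hdV' hdV0 hdW0 hdV'0 sB Φ (x.2 : HA L e dV hdV dW hdW) :=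
      funext fun x => hsec _ (show IsSiegelDelta L e dV hdV dW hdW (x.1 : HA L e dV hdV dW hdW) from x.1.2) _
    rw [heq]
    refine ((continuous_siegelDeltaCharacter_subtype L e dV hdV dW hdW (χ ^ M₂) _).comp continuous_fst).mul ?_
    -- the `K`-part: a coefficient-continuous orbit with finite-dimensional span through the fixed operator `ω(r_F(δ′))`
    have horb := continuous_apply_linearMap_of_finiteDimensional_span (piSchwartzBruhat (Fp L) (Fin (n' + n')))
      (fun k : 𝒦.K => adelicMpCont.omega (Fp L) (Fin (n' + n'))
        (gramDA L e' dV hdV (tensorFrame L dW eW dV') (tensorFrame_real L dW hdW eW dV' hdV'))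
        (sB (tensorEmb L e dV hdV dW hdW eW e' dV' hdV' (k : HA L e dV hdV dW hdW))) Φ)
      (fun x => (adelicMpCont.continuous_omega_apply (F := Fp L) (ι := Fin (n' + n'))
        (T := gramDA L e' dV hdV (tensorFrame L dW eW dV') (tensorFrame_real L dW hdW eW dV' hdV')) Φ x).comp
        (hsB.continuous.comp ((continuous_tensorEmb L e dV hdV dW hdW eW e' dV' hdV').comp continuous_subtype_val)))
      hΦ (adelicMpCont.omega (Fp L) (Fin (n' + n')) (gramDA L e' dV hdV (tensorFrame L dW eW dV') (tensorFrame_real L dW hdW eW dV' hdV'))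
        (rDelta L e' dV hdV hdV0 (tensorFrame L dW eW dV') (tensorFrame_real L dW hdW eW dV' hdV') (tensorFrame_ne_zero L dW eW dV' hdW0 hdV'0))) 0
    have hK : Continuous fun k : 𝒦.K =>
        swSectionTensor L e dV hdV dW hdW eW e' dV' hdV' hdV0 hdW0 hdV'0 sB Φ (k : HA L e dV hdV dW hdW) := by
      refine horb.congr fun k => ?_
      have hop := LinearMap.congr_fun
        ((adelicMpCont.omega (Fp L) (Fin (n' + n')) (gramDA L e' dV hdV (tensorFrame L dW eW dV') (tensorFrame_real L dW hdW eW dV' hdV'))).map_mul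
          (rDelta L e' dV hdV hdV0 (tensorFrame L dW eW dV') (tensorFrame_real L dW hdW eW dV' hdV') (tensorFrame_ne_zero L dW eW dV' hdW0 hdV'0))
          (sB (tensorEmb L e dV hdV dW hdW eW e' dV' hdV' (k : HA L e dV hdV dW hdW)))) Φ
      exact (congrArg (fun T : piSchwartzBruhat (Fp L) (Fin (n' + n')) => (T : (Fin (n' + n') → AdeleRing (𝓞 (Fp L)) (Fp L)) → ℂ) 0) hop).symm
    exact hK.comp continuous_snd

/-! ## §3 THE PACKAGE: the μ-twisted Siegel–Weil standard family of an `M₂`-frame is a continuous standard family for `(𝒦, χ^{M₂}·α̃)` -/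

variable (α : UnitaryGroup.adelicOne (Fp L) L (IsCMField.complexConj L) →* ℂˣ)

include hdV'0 in
/-- **THE COHERENT GENERATOR IS A STANDARD FAMILY.**  For `sB` a `χ`-normalised doubled Weil representation of the big datum, `M₂ ≠ 0`, a SMALL Iwasawa
datum `𝒦`, `Φ` with finite-dimensional `tensorEmb(K)`-orbit span, and a continuous automorphic `α`: the family
`s h ↦ α(det h) · stdExtension 𝒦 ((M₂ − n)/2) (swSectionTensor sB Φ) s h` is a STANDARD family of Siegel sections for `(𝒦, χ^{M₂}·α̃)` — holomorphic,
`K`-finite, flat (★ `isStandardSectionFamily_stdExtension` + ★ `IwasawaDatum.modDelta_eq_one_of_mem` + §1 + ★ `isSiegelDeltaSection_swSectionTensor`, then ★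
`isStandardSectionFamily_detTwist`).  For hLiu418: `n = 2`, `M₂ = 3`, `χ := λ̃⁻¹`, `α̃ := λ̃²`, character `λ̃⁻¹ = χ_D` of socket #42R.
[cite: KudlaRallis1994, §1] [cite: HarrisKudlaSweet1996, §1 (1.15)–(1.17)] [cite: GelbartRogawski1991, §3.1 Remark p. 457 L9–13] -/
theorem isStandardSectionFamily_swTensorTwisted (hM₂ : M₂ ≠ 0) {χ : HeckeCharacter L}
    {sB : HA L e' dV hdV (tensorFrame L dW eW dV') (tensorFrame_real L dW hdW eW dV' hdV') →*
      MpD L e' dV hdV (tensorFrame L dW eW dV') (tensorFrame_real L dW hdW eW dV' hdV')}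
    (hsB : IsDoubledWeilRep L e' dV hdV hdV0 (tensorFrame L dW eW dV') (tensorFrame_real L dW hdW eW dV' hdV')
      (tensorFrame_ne_zero L dW eW dV' hdW0 hdV'0) χ sB)
    (𝒦 : IwasawaDatum L e dV hdV dW hdW) (Φ : piSchwartzBruhat (Fp L) (Fin (n' + n')))
    (hΦ : FiniteDimensional ℂ (Submodule.span ℂ (Set.range fun k : 𝒦.K =>
      adelicMpCont.omega (Fp L) (Fin (n' + n')) (gramDA L e' dV hdV (tensorFrame L dW eW dV') (tensorFrame_real L dW hdW eW dV' hdV'))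
        (sB (tensorEmb L e dV hdV dW hdW eW e' dV' hdV' (k : HA L e dV hdV dW hdW))) Φ)))
    (hα : Continuous α)
    (hαrat : ∀ u : UnitaryGroup.adelicOne (Fp L) L (IsCMField.complexConj L), (u : ideleGroup L) ∈ principalIdeles L → α u = 1) :
    IsStandardSectionFamily 𝒦 (χ ^ M₂ * ratioHecke L α hα hαrat)
      (fun s h => ((detChar L e dV hdV hdV0 dW hdW hdW0 α h : ℂˣ) : ℂ) *
        stdExtension 𝒦 (((M₂ : ℂ) - (n : ℂ)) / 2) (swSectionTensor L e dV hdV dW hdW eW e' dV' hdV' hdV0 hdW0 hdV'0 sB Φ) s h) :=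
  isStandardSectionFamily_detTwist L e dV hdV hdV0 dW hdW hdW0 α hα hαrat
    (isStandardSectionFamily_stdExtension (IwasawaDatum.modDelta_eq_one_of_mem L e dV hdV hdV0 dW hdW hdW0 𝒦)
      (isSiegelDeltaSection_swSectionTensor L e dV hdV dW hdW eW e' dV' hdV' hdV0 hdW0 hdV'0 hM₂ hsB Φ)
      (isKFinite_swSectionTensor L e dV hdV hdV0 dW hdW hdW0 eW e' dV' hdV' hdV'0 𝒦 sB Φ hΦ))

include hdV'0 in
/-- **THE COHERENT GENERATOR IS CONTINUOUS** in `h` for every `s` (★ `continuous_detTwist` ∘ ★ `continuous_stdExtension` ∘ `continuous_swSectionTensor`) — the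
binder `hgc` of the glue ★ `residueIsThetaLift_of_generators` and the `Continuous f` of ★ socket #9. [cite: KudlaRallis1994, §1] [cite: Weil1964, Chap. III n° 39 p. 189] -/
theorem continuous_swTensorTwisted (hM₂ : M₂ ≠ 0) {χ : HeckeCharacter L}
    {sB : HA L e' dV hdV (tensorFrame L dW eW dV') (tensorFrame_real L dW hdW eW dV' hdV') →*
      MpD L e' dV hdV (tensorFrame L dW eW dV') (tensorFrame_real L dW hdW eW dV' hdV')}
    (hsB : IsDoubledWeilRep L e' dV hdV hdV0 (tensorFrame L dW eW dV') (tensorFrame_real L dW hdW eW dV' hdV')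
      (tensorFrame_ne_zero L dW eW dV' hdW0 hdV'0) χ sB)
    (𝒦 : IwasawaDatum L e dV hdV dW hdW) (Φ : piSchwartzBruhat (Fp L) (Fin (n' + n')))
    (hΦ : FiniteDimensional ℂ (Submodule.span ℂ (Set.range fun k : 𝒦.K =>
      adelicMpCont.omega (Fp L) (Fin (n' + n')) (gramDA L e' dV hdV (tensorFrame L dW eW dV') (tensorFrame_real L dW hdW eW dV' hdV'))
        (sB (tensorEmb L e dV hdV dW hdW eW e' dV' hdV' (k : HA L e dV hdV dW hdW))) Φ)))
    (hα : Continuous α) (s : ℂ) :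
    Continuous fun h => ((detChar L e dV hdV hdV0 dW hdW hdW0 α h : ℂˣ) : ℂ) *
      stdExtension 𝒦 (((M₂ : ℂ) - (n : ℂ)) / 2) (swSectionTensor L e dV hdV dW hdW eW e' dV' hdV' hdV0 hdW0 hdV'0 sB Φ) s h :=
  continuous_detTwist L e dV hdV hdV0 dW hdW hdW0 α hα
    (continuous_stdExtension L e dV hdV hdV0 dW hdW hdW0 𝒦 _
      (continuous_swSectionTensor L e dV hdV hdV0 dW hdW hdW0 eW e' dV' hdV' hdV'0 hM₂ hsB 𝒦 Φ hΦ) s)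

include hdV'0 in
/-- and, read off the package, it is a family of SIEGEL SECTIONS of `I(s, χ^{M₂}·α̃)` — the binder `hg` of the glue.
[cite: KudlaRallis1994, §1] [cite: Tan1999, §1] -/
theorem isSiegelDeltaSection_swTensorTwisted (hM₂ : M₂ ≠ 0) {χ : HeckeCharacter L}
    {sB : HA L e' dV hdV (tensorFrame L dW eW dV') (tensorFrame_real L dW hdW eW dV' hdV') →*
      MpD L e' dV hdV (tensorFrame L dW eW dV') (tensorFrame_real L dW hdW eW dV' hdV')}
    (hsB : IsDoubledWeilRep L e' dV hdV hdV0 (tensorFrame L dW eW dV') (tensorFrame_real L dW hdW eW dV' hdV')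
      (tensorFrame_ne_zero L dW eW dV' hdW0 hdV'0) χ sB)
    (𝒦 : IwasawaDatum L e dV hdV dW hdW) (Φ : piSchwartzBruhat (Fp L) (Fin (n' + n')))
    (hΦ : FiniteDimensional ℂ (Submodule.span ℂ (Set.range fun k : 𝒦.K =>
      adelicMpCont.omega (Fp L) (Fin (n' + n')) (gramDA L e' dV hdV (tensorFrame L dW eW dV') (tensorFrame_real L dW hdW eW dV' hdV'))
        (sB (tensorEmb L e dV hdV dW hdW eW e' dV' hdV' (k : HA L e dV hdV dW hdW))) Φ)))
    (hα : Continuous α)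
    (hαrat : ∀ u : UnitaryGroup.adelicOne (Fp L) L (IsCMField.complexConj L), (u : ideleGroup L) ∈ principalIdeles L → α u = 1) (s : ℂ) :
    IsSiegelDeltaSection L e dV hdV dW hdW (χ ^ M₂ * ratioHecke L α hα hαrat) s
      (fun h => ((detChar L e dV hdV hdV0 dW hdW hdW0 α h : ℂˣ) : ℂ) *
        stdExtension 𝒦 (((M₂ : ℂ) - (n : ℂ)) / 2) (swSectionTensor L e dV hdV dW hdW eW e' dV' hdV' hdV0 hdW0 hdV'0 sB Φ) s h) :=
  (isStandardSectionFamily_swTensorTwisted L e dV hdV hdV0 dW hdW hdW0 eW e' dV' hdV' hdV'0 α hM₂ hsB 𝒦 Φ hΦ hα hαrat).1.1 s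

end Summit.HodgeConjecture.HodgeConjecture.Cruxes.HLiu418.K2LiuSiegelWeilTensorGenerator

end
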